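import Mathlib.Probability.Moments.Tilted
import HarnessLib

/-!
# `ColdBoxSourcedPressure` (stmt-QuantumFields-23996) / `SourcedPressureDecoupling` (stmt-QuantumFields-23808), helper:
# the second-order Taylor bound of a cumulant generating function by the TILTED variance

The step «Taylor in `h` to second order against an `h̃`-tilted susceptibility bound» named in the plans of the
sourced-pressure items of route `SourcedPressureJensen` (the sourced increment
`|Λ|⁻¹ log E_β exp(−h Σ_x H_x)` is the cumulant generating function of `X = Σ_x H_x` at `−h`), as abstract
probability:

* **`cgf_le_of_variance_tilted_le`** — for a probability measure `μ`, a real random variable `X` with all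
  exponential moments and `h > 0`: if `Var[X; μ.tilted (u·X)] ≤ V` for all `0 < u < h`, then
  `log ∫ e^{hX} dμ ≤ h·E_μ X + V h²/2` (Mathlib: `cgf` is smooth on the interior of `integrableExpSet`,
  `exists_cgf_eq_iteratedDeriv_two_cgf_mul` = Taylor–Lagrange at order two for the centred variable, and
  `variance_tilted_mul`: `cgf'' (u) = Var[X; μ.tilted (u·X)]`);
* **`log_integral_exp_neg_mul_le_of_variance_tilted_le`** — the sourced sign:
  `log ∫ e^{−hX} dμ ≤ −h·E_μ X + V h²/2` if `Var[X; μ.tilted (−u·X)] ≤ V` on `0 < u < h`;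
* **`variance_tilted_neg_mul_le_exp_mul_variance`** — the UNTILTED window: if `|X − E_μ X| ≤ B` a.e. then
  `Var[X; μ.tilted (−u·X)] ≤ e^{2uB} · Var[X; μ]` for `u ≥ 0` (density `e^{−u(X−EX)}/Z ∈ [e^{−uB}/Z, e^{uB}/Z]`,
  `Z ≥ e^{−uB}`), hence
  **`log_integral_exp_neg_mul_le_of_abs_sub_le`**: `log ∫ e^{−hX} dμ ≤ −h·E_μ X + e^{2hB} Var[X; μ] h²/2`
  — a sup-norm-window bound (useful exactly when `hB ≲ 1`) requiring no control of tilted measures.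

Mathlib-only imports; generic (any probability space).  Use: with `X = Σ_{x∈Λ} H_x` under a finite-volume
Wilson measure, the first bullet turns a volume-normalised tilted susceptibility bound `|Λ|⁻¹Var_{h̃}(X) ≤ 2M`
(`0 < h̃ < h`) plus a covariance floor `|Λ|⁻¹E X ≥ σC(n)² − Cβ^{−κ}` into the sourced-increment bound
`|Λ|⁻¹ log E e^{−hX} ≤ −hσC(n)² + hCβ^{−κ} + Mh²`.  Everything is proved; no definition, no named fact.
RECORD-label rung support; the Yang–Mills mass gap is NOT proved by anything here. [folklore]
-/

noncomputable section

open MeasureTheory ProbabilityTheory Real Set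

namespace Summit.QuantumFields.YangMills.Theorems.SourcedPressureJensen

variable {Ω : Type*} [MeasurableSpace Ω] {μ : Measure Ω} {X : Ω → ℝ}

/-! ### Exponential moments everywhere: bookkeeping -/

/-- If all exponential moments exist, `integrableExpSet X μ = univ`. [folklore] -/
theorem integrableExpSet_eq_univ (hX : ∀ t : ℝ, Integrable (fun ω => exp (t * X ω)) μ) :
    integrableExpSet X μ = Set.univ :=
  Set.eq_univ_of_forall fun t => hX t

/-- If all exponential moments exist, every real is in the interior of `integrableExpSet X μ`. [folklore] -/
theorem mem_interior_integrableExpSet (hX : ∀ t : ℝ, Integrable (fun ω => exp (t * X ω)) μ) (v : ℝ) :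
    v ∈ interior (integrableExpSet X μ) := by
  rw [integrableExpSet_eq_univ hX, interior_univ]
  exact Set.mem_univ v

/-- All exponential moments of `X` exist iff they do for `X - c`. [folklore] -/
theorem integrable_exp_mul_sub_const (hX : ∀ t : ℝ, Integrable (fun ω => exp (t * X ω)) μ) (c t : ℝ) :
    Integrable (fun ω => exp (t * (X ω - c))) μ := by
  have : (fun ω => exp (t * (X ω - c))) = fun ω => exp (-(t * c)) * exp (t * X ω) := by
    ext ω
    rw [← Real.exp_add]
    ring_nf
  rw [this]
  exact (hX t).const_mul _

/-- All exponential moments of `X` exist iff they do for `-X`. [folklore] -/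
theorem integrable_exp_mul_neg (hX : ∀ t : ℝ, Integrable (fun ω => exp (t * X ω)) μ) (t : ℝ) :
    Integrable (fun ω => exp (t * -X ω)) μ := by
  have : (fun ω => exp (t * -X ω)) = fun ω => exp (-t * X ω) := by
    ext ω; ring_nf
  rw [this]
  exact hX (-t)

/-- A.e.-bounded random variables on a finite measure space have all exponential moments. [folklore] -/
theorem integrable_exp_mul_of_abs_le [IsFiniteMeasure μ] (hXm : AEStronglyMeasurable X μ) {K : ℝ}
    (hK : ∀ᵐ ω ∂μ, |X ω| ≤ K) (t : ℝ) : Integrable (fun ω => exp (t * X ω)) μ := by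
  refine (integrable_const (exp (|t| * K))).mono' (by fun_prop) ?_
  filter_upwards [hK] with ω hω
  rw [Real.norm_eq_abs, abs_of_pos (exp_pos _), exp_le_exp]
  calc t * X ω ≤ |t * X ω| := le_abs_self _
    _ = |t| * |X ω| := abs_mul _ _
    _ ≤ |t| * K := mul_le_mul_of_nonneg_left hω (abs_nonneg _)

/-- The cumulant generating function of the centred variable: `cgf (X - E X) t = cgf X t - t·E X`
(probability measure, all exponential moments). [folklore] -/
theorem cgf_sub_integral [IsProbabilityMeasure μ] (hX : ∀ t : ℝ, Integrable (fun ω => exp (t * X ω)) μ)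
    (t : ℝ) : cgf (fun ω => X ω - μ[X]) μ t = cgf X μ t - t * μ[X] := by
  simp only [cgf]
  rw [show (fun ω => X ω - μ[X]) = fun ω => X ω + -μ[X] from funext fun ω => sub_eq_add_neg _ _,
    mgf_add_const, Real.log_mul (mgf_pos (hX t)).ne' (exp_pos _).ne', Real.log_exp]
  ring

/-! ### The Taylor bound by the tilted variance -/

/-- **Second-order Taylor bound of the cumulant generating function by the tilted variance.**  For a
probability measure `μ`, a random variable `X` with all exponential moments and `h > 0`: if the variance of
`X` under every tilted measure `μ.tilted (u·X)`, `0 < u < h`, is at most `V`, then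
`cgf X μ h = log ∫ e^{hX} dμ ≤ h · E_μ[X] + V · h²/2`.  (Taylor–Lagrange at order two for the centred
variable, `cgf''(u) = Var[X; μ.tilted (u·X)]`.) [folklore] -/
theorem cgf_le_of_variance_tilted_le [IsProbabilityMeasure μ]
    (hX : ∀ t : ℝ, Integrable (fun ω => exp (t * X ω)) μ) {h V : ℝ} (hh : 0 < h)
    (hV : ∀ u ∈ Set.Ioo 0 h, Var[X; μ.tilted (fun ω => u * X ω)] ≤ V) :
    cgf X μ h ≤ h * μ[X] + V * h ^ 2 / 2 := by
  set Y : Ω → ℝ := fun ω => X ω - μ[X] with hY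
  have hXm : AEStronglyMeasurable X μ :=
    (aemeasurable_of_mem_interior_integrableExpSet (mem_interior_integrableExpSet hX 0)).aestronglyMeasurable
  have hXint : Integrable X μ := integrable_of_mem_interior_integrableExpSet (mem_interior_integrableExpSet hX 0)
  have hYexp : ∀ t : ℝ, Integrable (fun ω => exp (t * Y ω)) μ := fun t => integrable_exp_mul_sub_const hX _ t
  have hYc : μ[Y] = 0 := by
    simp only [hY]
    rw [integral_sub hXint (integrable_const _), integral_const]
    simp
  obtain ⟨u, hu, hcgf⟩ := exists_cgf_eq_iteratedDeriv_two_cgf_mul (X := Y) (μ := μ) hh hYc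
    (fun v _ => mem_interior_integrableExpSet hYexp v)
  -- the second derivative is the tilted variance, and tilting by `u·Y` or `u·X` is the same measure
  haveI : IsProbabilityMeasure (μ.tilted fun ω => u * X ω) := isProbabilityMeasure_tilted (hX u)
  have htilt : μ.tilted (fun ω => u * Y ω) = μ.tilted (fun ω => u * X ω) := by
    have hsplit : (fun ω => u * Y ω) = (fun ω => u * X ω) + fun _ => -(u * μ[X]) := by
      ext ω
      simp only [hY, Pi.add_apply]
      ring
    rw [hsplit, ← tilted_tilted (hX u), tilted_const]
  have hvar : iteratedDeriv 2 (cgf Y μ) u = Var[X; μ.tilted (fun ω => u * X ω)] := by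
    rw [← variance_tilted_mul (mem_interior_integrableExpSet hYexp u)]
    change Var[Y; μ.tilted (fun ω => u * Y ω)] = _
    rw [htilt, hY]
    exact variance_sub_const (hXm.mono_ac (tilted_absolutelyContinuous _ _)) _
  have hcgfX : cgf X μ h = h * μ[X] + cgf Y μ h := by
    rw [hY, cgf_sub_integral hX]
    ring
  rw [hcgfX, hcgf, hvar]
  have hh2 : 0 ≤ h ^ 2 / 2 := by positivity
  nlinarith [hV u hu, hh2]

/-- **The sourced sign.**  If `Var[X; μ.tilted (−u·X)] ≤ V` for all `0 < u < h` (`h > 0`), then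
`log ∫ e^{−hX} dμ ≤ −h · E_μ[X] + V · h²/2`. [folklore] -/
theorem log_integral_exp_neg_mul_le_of_variance_tilted_le [IsProbabilityMeasure μ]
    (hX : ∀ t : ℝ, Integrable (fun ω => exp (t * X ω)) μ) {h V : ℝ} (hh : 0 < h)
    (hV : ∀ u ∈ Set.Ioo 0 h, Var[X; μ.tilted (fun ω => -u * X ω)] ≤ V) :
    Real.log (∫ ω, exp (-h * X ω) ∂μ) ≤ -h * μ[X] + V * h ^ 2 / 2 := by
  have hnX : ∀ t : ℝ, Integrable (fun ω => exp (t * (-X) ω)) μ := fun t => integrable_exp_mul_neg hX t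
  have h1 := cgf_le_of_variance_tilted_le (X := -X) hnX hh (V := V) (fun u hu => by
    have e1 : (fun ω => u * (-X) ω) = fun ω => -u * X ω := by ext ω; simp only [Pi.neg_apply]; ring
    rw [e1, variance_neg]
    exact hV u hu)
  have e2 : cgf (-X) μ h = Real.log (∫ ω, exp (-h * X ω) ∂μ) := by
    simp only [cgf, mgf, Pi.neg_apply, mul_neg, neg_mul]
  have e3 : μ[-X] = -μ[X] := integral_neg X
  rw [e2, e3] at h1
  linarith

/-! ### The untilted window -/

/-- **Tilted variance versus untilted variance for a bounded fluctuation.**  If `|X − E_μ X| ≤ B` a.e. and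
`u ≥ 0`, then `Var[X; μ.tilted (−u·X)] ≤ e^{2uB} · Var[X; μ]`: the tilted density `e^{−u(X − EX)}/Z` lies in
`[e^{−uB}/Z, e^{uB}/Z]` with `Z ≥ e^{−uB}`, and the tilted variance is at most the tilted second moment about
`E_μ X`. [folklore] -/
theorem variance_tilted_neg_mul_le_exp_mul_variance [IsProbabilityMeasure μ] (hXm : AEStronglyMeasurable X μ)
    {B u : ℝ} (hu : 0 ≤ u) (hB : ∀ᵐ ω ∂μ, |X ω - μ[X]| ≤ B) :
    Var[X; μ.tilted (fun ω => -u * X ω)] ≤ exp (2 * u * B) * Var[X; μ] := by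
  -- `X` is bounded, hence has all exponential moments
  have hXb : ∀ᵐ ω ∂μ, |X ω| ≤ B + |μ[X]| := by
    filter_upwards [hB] with ω hω
    calc |X ω| = |(X ω - μ[X]) + μ[X]| := by ring_nf
      _ ≤ |X ω - μ[X]| + |μ[X]| := abs_add_le _ _
      _ ≤ B + |μ[X]| := by linarith
  have hX : ∀ t : ℝ, Integrable (fun ω => exp (t * X ω)) μ := integrable_exp_mul_of_abs_le hXm hXb
  set ν : Measure Ω := μ.tilted (fun ω => -u * X ω) with hν
  haveI : IsProbabilityMeasure ν := isProbabilityMeasure_tilted (hX (-u))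
  -- tilted variance ≤ tilted second moment about `E_μ X`
  have hXmν : AEStronglyMeasurable X ν := hXm.mono_ac (tilted_absolutelyContinuous _ _)
  have step1 : Var[X; ν] ≤ ν[fun ω => (X ω - μ[X]) ^ 2] := by
    have h := variance_le_expectation_sq (μ := ν) (X := fun ω => X ω - μ[X]) (hXmν.sub aestronglyMeasurable_const)
    rw [variance_sub_const hXmν] at h
    simpa only [Pi.pow_apply] using h
  -- write the tilted second moment as a ratio of `μ`-integrals of the centred density
  set Z : ℝ := ∫ ω, exp (-u * X ω) ∂μ with hZ
  have hZpos : 0 < Z := integral_exp_pos (hX (-u))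
  have step2 : ν[fun ω => (X ω - μ[X]) ^ 2] = (∫ ω, exp (-u * X ω) * (X ω - μ[X]) ^ 2 ∂μ) / Z := by
    rw [hν, integral_tilted]
    simp only [smul_eq_mul]
    rw [← integral_div]
    refine integral_congr_ae (ae_of_all _ fun ω => ?_)
    simp only
    ring
  -- numerator ≤ e^{-u E X} e^{uB} ∫ (X - EX)², denominator ≥ e^{-u E X} e^{-uB}
  have hnum : ∫ ω, exp (-u * X ω) * (X ω - μ[X]) ^ 2 ∂μ ≤
      exp (-u * μ[X]) * exp (u * B) * ∫ ω, (X ω - μ[X]) ^ 2 ∂μ := by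
    rw [← integral_const_mul]
    refine integral_mono_ae ?_ ?_ ?_
    · have h2 : Integrable (fun ω => (X ω - μ[X]) ^ 2) μ := by
        refine (integrable_const (B ^ 2)).mono' (by fun_prop) ?_
        filter_upwards [hB] with ω hω
        rw [Real.norm_eq_abs, abs_pow, sq_abs]
        calc (X ω - μ[X]) ^ 2 = |X ω - μ[X]| ^ 2 := (sq_abs _).symm
          _ ≤ B ^ 2 := pow_le_pow_left₀ (abs_nonneg _) hω 2
      refine (h2.const_mul (exp (-u * μ[X]) * exp (u * B))).mono' (by fun_prop) ?_
      filter_upwards [hB] with ω hω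
      rw [Real.norm_eq_abs, abs_mul, abs_of_pos (exp_pos _), abs_of_nonneg (sq_nonneg _)]
      refine mul_le_mul_of_nonneg_right ?_ (sq_nonneg _)
      rw [← Real.exp_add, exp_le_exp]
      have : -u * X ω = -u * μ[X] + -u * (X ω - μ[X]) := by ring
      rw [this]
      have h3 : -u * (X ω - μ[X]) ≤ u * B := by
        have := neg_abs_le (X ω - μ[X])
        nlinarith
      linarith
    · exact ((integrable_const (B ^ 2)).mono' (by fun_prop) (by
        filter_upwards [hB] with ω hω
        rw [Real.norm_eq_abs, abs_pow, sq_abs]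
        calc (X ω - μ[X]) ^ 2 = |X ω - μ[X]| ^ 2 := (sq_abs _).symm
          _ ≤ B ^ 2 := pow_le_pow_left₀ (abs_nonneg _) hω 2)).const_mul _
    · filter_upwards [hB] with ω hω
      refine mul_le_mul_of_nonneg_right ?_ (sq_nonneg _)
      rw [← Real.exp_add, exp_le_exp]
      have : -u * X ω = -u * μ[X] + -u * (X ω - μ[X]) := by ring
      rw [this]
      have h3 : -u * (X ω - μ[X]) ≤ u * B := by
        have := neg_abs_le (X ω - μ[X])
        nlinarith
      linarith
  have hden : exp (-u * μ[X]) * exp (-(u * B)) ≤ Z := by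
    rw [hZ, ← Real.exp_add]
    have hc : ∫ _ : Ω, exp (-u * μ[X] + -(u * B)) ∂μ = exp (-u * μ[X] + -(u * B)) := by
      rw [integral_const]; simp
    rw [← hc]
    refine integral_mono_ae (integrable_const _) (hX (-u)) ?_
    filter_upwards [hB] with ω hω
    rw [exp_le_exp]
    have : -u * X ω = -u * μ[X] + -u * (X ω - μ[X]) := by ring
    rw [this]
    have h3 : -(u * B) ≤ -u * (X ω - μ[X]) := by
      have := le_abs_self (X ω - μ[X])
      nlinarith
    linarith
  have hvarμ : Var[X; μ] = ∫ ω, (X ω - μ[X]) ^ 2 ∂μ := variance_eq_integral hXm.aemeasurable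
  have hVnn : 0 ≤ ∫ ω, (X ω - μ[X]) ^ 2 ∂μ := integral_nonneg fun ω => sq_nonneg _
  calc Var[X; ν] ≤ ν[fun ω => (X ω - μ[X]) ^ 2] := step1
    _ = (∫ ω, exp (-u * X ω) * (X ω - μ[X]) ^ 2 ∂μ) / Z := step2
    _ ≤ (exp (-u * μ[X]) * exp (u * B) * ∫ ω, (X ω - μ[X]) ^ 2 ∂μ) / Z :=
        div_le_div_of_nonneg_right hnum hZpos.le
    _ ≤ (exp (-u * μ[X]) * exp (u * B) * ∫ ω, (X ω - μ[X]) ^ 2 ∂μ) / (exp (-u * μ[X]) * exp (-(u * B))) :=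
        div_le_div_of_nonneg_left (by positivity) (by positivity) hden
    _ = exp (2 * u * B) * Var[X; μ] := by
        rw [hvarμ]
        have h1 : exp (-u * μ[X]) ≠ 0 := (exp_pos _).ne'
        have h2 : exp (-(u * B)) ≠ 0 := (exp_pos _).ne'
        rw [show exp (2 * u * B) = exp (u * B) / exp (-(u * B)) by
          rw [← Real.exp_sub]; ring_nf]
        field_simp

/-- **The untilted window bound.**  If `|X − E_μ X| ≤ B` a.e. and `h > 0`, then
`log ∫ e^{−hX} dμ ≤ −h · E_μ X + e^{2hB} · Var[X; μ] · h²/2` — no tilted measure needs to be controlled; the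
price is the factor `e^{2hB}`, harmless exactly in the window `hB ≲ 1`. [folklore] -/
theorem log_integral_exp_neg_mul_le_of_abs_sub_le [IsProbabilityMeasure μ] (hXm : AEStronglyMeasurable X μ)
    {B h : ℝ} (hh : 0 < h) (hB : ∀ᵐ ω ∂μ, |X ω - μ[X]| ≤ B) :
    Real.log (∫ ω, exp (-h * X ω) ∂μ) ≤ -h * μ[X] + exp (2 * h * B) * Var[X; μ] * h ^ 2 / 2 := by
  have hXb : ∀ᵐ ω ∂μ, |X ω| ≤ B + |μ[X]| := by
    filter_upwards [hB] with ω hω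
    calc |X ω| = |(X ω - μ[X]) + μ[X]| := by ring_nf
      _ ≤ |X ω - μ[X]| + |μ[X]| := abs_add_le _ _
      _ ≤ B + |μ[X]| := by linarith
  have hX : ∀ t : ℝ, Integrable (fun ω => exp (t * X ω)) μ := integrable_exp_mul_of_abs_le hXm hXb
  have hBnn : 0 ≤ B := by
    obtain ⟨ω, hω⟩ := hB.exists
    exact (abs_nonneg _).trans hω
  refine log_integral_exp_neg_mul_le_of_variance_tilted_le hX hh (V := exp (2 * h * B) * Var[X; μ])
    (fun u hu => ?_) |>.trans (le_of_eq (by ring))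
  refine (variance_tilted_neg_mul_le_exp_mul_variance hXm hu.1.le hB).trans ?_
  refine mul_le_mul_of_nonneg_right ?_ (variance_nonneg X μ)
  rw [exp_le_exp]
  nlinarith [hu.2, hBnn]

end Summit.QuantumFields.YangMills.Theorems.SourcedPressureJensen
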